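import Mathlib
import Summits.NavierStokesRegularity.NavierStokesRegularity.Theorems.EulerZoomLiouvillePowerGaugeEulerLiouvilleHoopSliceChart
import Summits.NavierStokesRegularity.NavierStokesRegularity.Theorems.EulerZoomLiouvillePowerGaugeEulerLiouvilleHoopSliceFrame

/-!
# Hoop core — AX-3 tools: chart forms of the axis-law averages, the axis atom, and the hoop integrand as a genuine integral

Sub-problem `NavierStokesRegularity`, crux `PowerGaugeEulerLiouville` (a crux CLASS of self-similar Euler/NS strata on the
MODEL lattice — not NS regularity, not E).  K-AXIS plate AX-3 (LEAD 19832 ns-typeII-p2 g14, 2026-08-29; seat ns-ezl-w3 g7):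
the `t`-integration of the circle-averaged radial law (AX-2) down to the axis.  Class-free calculus for `V ∈ C¹`, `P ∈ C⁰/C¹`,
about the `x₂`-axis, `y = axisPt s t θ`, smooth frame `f₀ = R_θ e₀`, `f₁ = R_θ e₁` (`= ê_r, ê_θ` for `t > 0`):

* §1 the radial slice law of `⟪V∘axisPt, R_θe₁⟫` (companion of `…HoopSliceChart.hasDerivAt_sliceA_radius`);
* §2 the chart forms of the circle averages `⟨V_r⟩`, `⟨V_r² − V_θ²⟩`, `⟨(γr + V_r)V_r⟩`, `⟨P⟩` and their calculus in `t` on ALL of `ℝ`;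
* §3 the AXIS ATOM: `⟨(γr + V_r)V_r⟩(s,t) → ½(‖V(s e_z)‖² − V_z(s e_z)²)` and `⟨P⟩(s,t) → P(s e_z)` as `t → 0⁺`;
* §4 the hoop integrand `⟨V_r² − V_θ²⟩(s,t)/t` is bounded on `(0, T₀]` (its chart form is `C¹` and vanishes at `t = 0`), hence
  `IntervalIntegrable` on `[0, T₀]` — the interval integral in `HoopCore.AxisLaw` is a genuine one.

Differentiation under `∫₀^{2π} dθ` is `…HoopSliceFrame.hasDerivAt_intervalIntegral_of_continuous` (ns-ezl-w2 g5).
WHAT THIS IS NOT: not NS, not E — calculus; 19832 OPEN; NS regularity NOT proved.  [folklore (cylinder coordinates, differentiation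
under the integral sign)]
-/

noncomputable section

open MeasureTheory Set WithLp Metric Real Function Filter Topology intervalIntegral
open scoped InnerProductSpace RealInnerProductSpace

set_option linter.dupNamespace false

namespace Summit.NavierStokesRegularity.NavierStokesRegularity.Theorems.PowerGaugeEulerLiouville.HoopCore

open Literature.Analysis Literature.Analysis.FluidPDE

variable {V : EuclideanSpace ℝ (Fin 3) → EuclideanSpace ℝ (Fin 3)}

/-! ## §1 One more slice law -/

/-- **Radial law of `b = ⟪V∘axisPt, R_θe₁⟫`**: `∂_t b = ⟪DV R_θe₀, R_θe₁⟫` (every `t`; companion of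
`hasDerivAt_sliceA_radius`). [folklore] -/
theorem hasDerivAt_sliceB_radius (hV : Differentiable ℝ V) (s t θ : ℝ) :
    HasDerivAt (fun t : ℝ => ⟪V (axisPt s t θ), rotZ θ (EuclideanSpace.single (1 : Fin 3) (1 : ℝ))⟫)
      ⟪fderiv ℝ V (axisPt s t θ) (rotZ θ (EuclideanSpace.single (0 : Fin 3) (1 : ℝ))),
        rotZ θ (EuclideanSpace.single (1 : Fin 3) (1 : ℝ))⟫ t := by
  have h1 : HasDerivAt (fun t : ℝ => V (axisPt s t θ))
      (fderiv ℝ V (axisPt s t θ) (rotZ θ (EuclideanSpace.single (0 : Fin 3) (1 : ℝ)))) t :=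
    (hV _).hasFDerivAt.comp_hasDerivAt t (hasDerivAt_axisPt_radius' s t θ)
  have h := h1.inner ℝ (hasDerivAt_const t (rotZ θ (EuclideanSpace.single (1 : Fin 3) (1 : ℝ))))
  simpa only [inner_zero_right, zero_add] using h

/-! ## §2 Chart forms of the circle averages and their calculus on all of `ℝ` -/

/-- **Chart form of `⟨V_r⟩`** (`t > 0`): `circleAvg (radialVelocity V) s t = (2π)⁻¹ ∫₀^{2π} ⟪V(axisPt s t θ), R_θe₀⟫ dθ`. [folklore] -/
theorem circleAvg_radialVelocity_eq_chart (V : EuclideanSpace ℝ (Fin 3) → EuclideanSpace ℝ (Fin 3)) (s : ℝ) {t : ℝ}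
    (ht : 0 < t) :
    circleAvg (radialVelocity V) s t =
      1 / (2 * Real.pi) * ∫ θ in (0 : ℝ)..2 * Real.pi, ⟪V (axisPt s t θ), rotZ θ (EuclideanSpace.single (0 : Fin 3) (1 : ℝ))⟫ := by
  rw [circleAvg]
  congr 1
  exact intervalIntegral.integral_congr fun θ _ => (inner_rotZ_single_zero_eq_radialVelocity V s ht θ).symm

/-- **Chart form of the hoop average `⟨V_r² − V_θ²⟩`** (`t > 0`). [folklore] -/
theorem circleAvg_hoop_eq_chart (V : EuclideanSpace ℝ (Fin 3) → EuclideanSpace ℝ (Fin 3)) (s : ℝ) {t : ℝ} (ht : 0 < t) :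
    circleAvg (fun y => radialVelocity V y ^ 2 - swirlVelocity V y ^ 2) s t =
      1 / (2 * Real.pi) * ∫ θ in (0 : ℝ)..2 * Real.pi,
        (⟪V (axisPt s t θ), rotZ θ (EuclideanSpace.single (0 : Fin 3) (1 : ℝ))⟫ ^ 2 -
          ⟪V (axisPt s t θ), rotZ θ (EuclideanSpace.single (1 : Fin 3) (1 : ℝ))⟫ ^ 2) := by
  rw [circleAvg]
  congr 1
  refine intervalIntegral.integral_congr fun θ _ => ?_
  simp only [inner_rotZ_single_zero_eq_radialVelocity V s ht θ, inner_rotZ_single_one_eq_swirlVelocity V s ht θ]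

/-- **Chart form of the lateral average `⟨(γ r + V_r) V_r⟩`** (`t > 0`). [folklore] -/
theorem circleAvg_lateral_eq_chart (V : EuclideanSpace ℝ (Fin 3) → EuclideanSpace ℝ (Fin 3)) (γ s : ℝ) {t : ℝ}
    (ht : 0 < t) :
    circleAvg (fun y => (γ * cylRadius y + radialVelocity V y) * radialVelocity V y) s t =
      1 / (2 * Real.pi) * ∫ θ in (0 : ℝ)..2 * Real.pi,
        (γ * t + ⟪V (axisPt s t θ), rotZ θ (EuclideanSpace.single (0 : Fin 3) (1 : ℝ))⟫) *
          ⟪V (axisPt s t θ), rotZ θ (EuclideanSpace.single (0 : Fin 3) (1 : ℝ))⟫ := by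
  rw [circleAvg]
  congr 1
  refine intervalIntegral.integral_congr fun θ _ => ?_
  simp only [cylRadius_axisPt s ht.le θ, inner_rotZ_single_zero_eq_radialVelocity V s ht θ]

/-- **The hoop integrand divided by the radius**: on the circle `cylRadius = t`, so
`circleAvg (fun y => (V_r² − V_θ²)/r) s t = circleAvg (V_r² − V_θ²) s t / t` (`t ≥ 0`). [folklore] -/
theorem circleAvg_hoop_div_cylRadius (V : EuclideanSpace ℝ (Fin 3) → EuclideanSpace ℝ (Fin 3)) (s : ℝ) {t : ℝ}
    (ht : 0 ≤ t) :
    circleAvg (fun y => (radialVelocity V y ^ 2 - swirlVelocity V y ^ 2) / cylRadius y) s t =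
      circleAvg (fun y => radialVelocity V y ^ 2 - swirlVelocity V y ^ 2) s t / t := by
  rw [circleAvg, circleAvg, mul_div_assoc]
  congr 1
  rw [← intervalIntegral.integral_div]
  exact intervalIntegral.integral_congr fun θ _ => by simp only [cylRadius_axisPt s ht θ]

/-- The chart integrand of `⟨V_r⟩` is jointly continuous in `(t, θ)` (fixed height). [folklore] -/
theorem continuous_chartA_radius (hV : Continuous V) (s : ℝ) :
    Continuous (uncurry fun t θ : ℝ => ⟪V (axisPt s t θ), rotZ θ (EuclideanSpace.single (0 : Fin 3) (1 : ℝ))⟫) :=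
  continuous_uncurry_slice (continuous_sliceA hV) s

/-- The chart integrand of `⟨V_θ⟩`-type terms is jointly continuous in `(t, θ)` (fixed height). [folklore] -/
theorem continuous_chartB_radius (hV : Continuous V) (s : ℝ) :
    Continuous (uncurry fun t θ : ℝ => ⟪V (axisPt s t θ), rotZ θ (EuclideanSpace.single (1 : Fin 3) (1 : ℝ))⟫) :=
  continuous_uncurry_slice (continuous_sliceB hV) s

/-- The radial frame entry `⟪DV(axisPt s t θ) R_θe₀, R_θe₀⟫` is jointly continuous in `(t, θ)`. [folklore] -/
theorem continuous_chartEntry00_radius (hV : ContDiff ℝ 1 V) (s : ℝ) :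
    Continuous (uncurry fun t θ : ℝ => ⟪fderiv ℝ V (axisPt s t θ) (rotZ θ (EuclideanSpace.single (0 : Fin 3) (1 : ℝ))),
      rotZ θ (EuclideanSpace.single (0 : Fin 3) (1 : ℝ))⟫) :=
  continuous_uncurry_slice (continuous_sliceEntry hV continuous_rotZ_single_zero continuous_rotZ_single_zero) s

/-- The frame entry `⟪DV(axisPt s t θ) R_θe₀, R_θe₁⟫` is jointly continuous in `(t, θ)`. [folklore] -/
theorem continuous_chartEntry01_radius (hV : ContDiff ℝ 1 V) (s : ℝ) :
    Continuous (uncurry fun t θ : ℝ => ⟪fderiv ℝ V (axisPt s t θ) (rotZ θ (EuclideanSpace.single (0 : Fin 3) (1 : ℝ))),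
      rotZ θ (EuclideanSpace.single (1 : Fin 3) (1 : ℝ))⟫) :=
  continuous_uncurry_slice (continuous_sliceEntry hV continuous_rotZ_single_zero continuous_rotZ_single_one) s

/-- **The chart form of `⟨V_r⟩` is continuous in `t` on all of `ℝ`.** [folklore] -/
theorem continuous_chartAvg_radialVelocity (hV : Continuous V) (s : ℝ) :
    Continuous fun t : ℝ => 1 / (2 * Real.pi) * ∫ θ in (0 : ℝ)..2 * Real.pi,
      ⟪V (axisPt s t θ), rotZ θ (EuclideanSpace.single (0 : Fin 3) (1 : ℝ))⟫ :=
  continuous_const.mul (intervalIntegral.continuous_parametric_intervalIntegral_of_continuous' (continuous_chartA_radius hV s) _ _)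

/-- **The chart form of the lateral average is differentiable in `t` on all of `ℝ`**, with derivative
`(2π)⁻¹ ∫₀^{2π} [γ A + (γ t + 2A) ⟪DV R_θe₀, R_θe₀⟫] dθ`. [folklore] -/
theorem hasDerivAt_chartAvg_lateral (hV : ContDiff ℝ 1 V) (γ s t : ℝ) :
    HasDerivAt (fun t : ℝ => 1 / (2 * Real.pi) * ∫ θ in (0 : ℝ)..2 * Real.pi,
        (γ * t + ⟪V (axisPt s t θ), rotZ θ (EuclideanSpace.single (0 : Fin 3) (1 : ℝ))⟫) *
          ⟪V (axisPt s t θ), rotZ θ (EuclideanSpace.single (0 : Fin 3) (1 : ℝ))⟫)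
      (1 / (2 * Real.pi) * ∫ θ in (0 : ℝ)..2 * Real.pi,
        (γ * ⟪V (axisPt s t θ), rotZ θ (EuclideanSpace.single (0 : Fin 3) (1 : ℝ))⟫ +
          (γ * t + 2 * ⟪V (axisPt s t θ), rotZ θ (EuclideanSpace.single (0 : Fin 3) (1 : ℝ))⟫) *
            ⟪fderiv ℝ V (axisPt s t θ) (rotZ θ (EuclideanSpace.single (0 : Fin 3) (1 : ℝ))),
              rotZ θ (EuclideanSpace.single (0 : Fin 3) (1 : ℝ))⟫)) t := by
  have hVc : Continuous V := hV.continuous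
  have hVd : Differentiable ℝ V := hV.differentiable one_ne_zero
  have hA := continuous_chartA_radius hVc s
  have hE := continuous_chartEntry00_radius hV s
  have hF : Continuous (uncurry fun t θ : ℝ =>
      (γ * t + ⟪V (axisPt s t θ), rotZ θ (EuclideanSpace.single (0 : Fin 3) (1 : ℝ))⟫) *
        ⟪V (axisPt s t θ), rotZ θ (EuclideanSpace.single (0 : Fin 3) (1 : ℝ))⟫) :=
    ((continuous_const.mul continuous_fst).add hA).mul hA
  have hF' : Continuous (uncurry fun t θ : ℝ =>
      γ * ⟪V (axisPt s t θ), rotZ θ (EuclideanSpace.single (0 : Fin 3) (1 : ℝ))⟫ +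
        (γ * t + 2 * ⟪V (axisPt s t θ), rotZ θ (EuclideanSpace.single (0 : Fin 3) (1 : ℝ))⟫) *
          ⟪fderiv ℝ V (axisPt s t θ) (rotZ θ (EuclideanSpace.single (0 : Fin 3) (1 : ℝ))),
            rotZ θ (EuclideanSpace.single (0 : Fin 3) (1 : ℝ))⟫) :=
    (continuous_const.mul hA).add (((continuous_const.mul continuous_fst).add (continuous_const.mul hA)).mul hE)
  have hd : ∀ t θ : ℝ, HasDerivAt (fun t : ℝ =>
      (γ * t + ⟪V (axisPt s t θ), rotZ θ (EuclideanSpace.single (0 : Fin 3) (1 : ℝ))⟫) *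
        ⟪V (axisPt s t θ), rotZ θ (EuclideanSpace.single (0 : Fin 3) (1 : ℝ))⟫)
      (γ * ⟪V (axisPt s t θ), rotZ θ (EuclideanSpace.single (0 : Fin 3) (1 : ℝ))⟫ +
        (γ * t + 2 * ⟪V (axisPt s t θ), rotZ θ (EuclideanSpace.single (0 : Fin 3) (1 : ℝ))⟫) *
          ⟪fderiv ℝ V (axisPt s t θ) (rotZ θ (EuclideanSpace.single (0 : Fin 3) (1 : ℝ))),
            rotZ θ (EuclideanSpace.single (0 : Fin 3) (1 : ℝ))⟫) t := by
    intro t θ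
    have hA' := hasDerivAt_sliceA_radius hVd s t θ
    exact ((((hasDerivAt_id t).const_mul γ).add hA').mul hA').congr_deriv (by simp only [id, Pi.add_apply]; ring)
  exact (hasDerivAt_intervalIntegral_of_continuous hd hF hF' 0 (2 * Real.pi) t).const_mul _

/-- **The chart form of the lateral average is continuous in `t` on all of `ℝ`.** [folklore] -/
theorem continuous_chartAvg_lateral (hV : ContDiff ℝ 1 V) (γ s : ℝ) :
    Continuous fun t : ℝ => 1 / (2 * Real.pi) * ∫ θ in (0 : ℝ)..2 * Real.pi,
      (γ * t + ⟪V (axisPt s t θ), rotZ θ (EuclideanSpace.single (0 : Fin 3) (1 : ℝ))⟫) *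
        ⟪V (axisPt s t θ), rotZ θ (EuclideanSpace.single (0 : Fin 3) (1 : ℝ))⟫ :=
  continuous_iff_continuousAt.2 fun t => (hasDerivAt_chartAvg_lateral hV γ s t).continuousAt

/-! ## §3 The axis atom and the axis value of `⟨P⟩` -/

/-- `‖v‖² − v₂² = v₀² + v₁²` in `ℝ³`. [folklore] -/
theorem norm_sq_sub_sq_two (v : EuclideanSpace ℝ (Fin 3)) : ‖v‖ ^ 2 - v 2 ^ 2 = v 0 ^ 2 + v 1 ^ 2 := by
  rw [← real_inner_self_eq_norm_sq, real_inner_eq_sum_three]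
  ring

/-- **The chart form of the lateral average AT the axis is the transverse atom**:
`(2π)⁻¹ ∫₀^{2π} (γ·0 + ⟪v, R_θe₀⟫) ⟪v, R_θe₀⟫ dθ = ½ (‖v‖² − v_z²)`, `v = V(s e_z)`. [folklore] -/
theorem chartAvg_lateral_zero (V : EuclideanSpace ℝ (Fin 3) → EuclideanSpace ℝ (Fin 3)) (γ s : ℝ) :
    1 / (2 * Real.pi) * ∫ θ in (0 : ℝ)..2 * Real.pi,
        (γ * 0 + ⟪V (axisPt s 0 θ), rotZ θ (EuclideanSpace.single (0 : Fin 3) (1 : ℝ))⟫) *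
          ⟪V (axisPt s 0 θ), rotZ θ (EuclideanSpace.single (0 : Fin 3) (1 : ℝ))⟫ =
      1 / 2 * (‖V (s • eZ)‖ ^ 2 - axialVelocity V (s • eZ) ^ 2) := by
  have e : (fun θ : ℝ => (γ * 0 + ⟪V (axisPt s 0 θ), rotZ θ (EuclideanSpace.single (0 : Fin 3) (1 : ℝ))⟫) *
      ⟪V (axisPt s 0 θ), rotZ θ (EuclideanSpace.single (0 : Fin 3) (1 : ℝ))⟫) =
      fun θ : ℝ => (V (s • eZ) 0 * Real.cos θ + V (s • eZ) 1 * Real.sin θ) ^ 2 := by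
    funext θ
    rw [mul_zero, zero_add, axisPt_radius_zero, inner_rotZ_single_zero, sq]
  rw [e, integral_firstMode_sq, axialVelocity, norm_sq_sub_sq_two]
  have hπ : Real.pi ≠ 0 := Real.pi_ne_zero
  field_simp

/-- **THE AXIS ATOM**: as `t → 0⁺`, `⟨(γ r + V_r) V_r⟩(s,t) → ½ (‖V(s e_z)‖² − V_z(s e_z)²)` (`V ∈ C¹`). [folklore] -/
theorem tendsto_circleAvg_lateral_atom (hV : ContDiff ℝ 1 V) (γ s : ℝ) :
    Tendsto (fun t : ℝ => circleAvg (fun y => (γ * cylRadius y + radialVelocity V y) * radialVelocity V y) s t)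
      (𝓝[>] 0) (𝓝 (1 / 2 * (‖V (s • eZ)‖ ^ 2 - axialVelocity V (s • eZ) ^ 2))) := by
  have hc := (continuous_chartAvg_lateral hV γ s).tendsto 0
  rw [chartAvg_lateral_zero V γ s] at hc
  refine (tendsto_nhdsWithin_of_tendsto_nhds hc).congr' ?_
  filter_upwards [self_mem_nhdsWithin] with t ht
  exact (circleAvg_lateral_eq_chart V γ s ht).symm

/-- `⟨P⟩(s, 0) = P(s e_z)`: the circle of radius `0` is the axis point. [folklore] -/
theorem circleAvg_radius_zero (P : EuclideanSpace ℝ (Fin 3) → ℝ) (s : ℝ) : circleAvg P s 0 = P (s • eZ) := by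
  rw [circleAvg]
  simp only [axisPt_radius_zero, intervalIntegral.integral_const, sub_zero, smul_eq_mul]
  have hπ : Real.pi ≠ 0 := Real.pi_ne_zero
  field_simp

/-- **`⟨P⟩(s, t) → P(s e_z)` as `t → 0⁺`** for continuous `P`. [folklore] -/
theorem tendsto_circleAvg_radius_zero {P : EuclideanSpace ℝ (Fin 3) → ℝ} (hP : Continuous P) (s : ℝ) :
    Tendsto (fun t : ℝ => circleAvg P s t) (𝓝[>] 0) (𝓝 (P (s • eZ))) := by
  have hc := (continuous_circleAvg_radius hP s).tendsto 0
  rw [circleAvg_radius_zero] at hc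
  exact tendsto_nhdsWithin_of_tendsto_nhds hc

/-! ## §4 The hoop integrand `⟨V_r² − V_θ²⟩/t` is a genuine integrand on `[0, T₀]` -/

/-- **The chart form of the hoop average is differentiable in `t` on all of `ℝ`**, with derivative
`(2π)⁻¹ ∫₀^{2π} [2A ⟪DV R_θe₀, R_θe₀⟫ − 2B ⟪DV R_θe₀, R_θe₁⟫] dθ` (`A = ⟪V, R_θe₀⟫`, `B = ⟪V, R_θe₁⟫`). [folklore] -/
theorem hasDerivAt_chartAvg_hoop (hV : ContDiff ℝ 1 V) (s t : ℝ) :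
    HasDerivAt (fun t : ℝ => 1 / (2 * Real.pi) * ∫ θ in (0 : ℝ)..2 * Real.pi,
        (⟪V (axisPt s t θ), rotZ θ (EuclideanSpace.single (0 : Fin 3) (1 : ℝ))⟫ ^ 2 -
          ⟪V (axisPt s t θ), rotZ θ (EuclideanSpace.single (1 : Fin 3) (1 : ℝ))⟫ ^ 2))
      (1 / (2 * Real.pi) * ∫ θ in (0 : ℝ)..2 * Real.pi,
        (2 * ⟪V (axisPt s t θ), rotZ θ (EuclideanSpace.single (0 : Fin 3) (1 : ℝ))⟫ *
            ⟪fderiv ℝ V (axisPt s t θ) (rotZ θ (EuclideanSpace.single (0 : Fin 3) (1 : ℝ))),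
              rotZ θ (EuclideanSpace.single (0 : Fin 3) (1 : ℝ))⟫ -
          2 * ⟪V (axisPt s t θ), rotZ θ (EuclideanSpace.single (1 : Fin 3) (1 : ℝ))⟫ *
            ⟪fderiv ℝ V (axisPt s t θ) (rotZ θ (EuclideanSpace.single (0 : Fin 3) (1 : ℝ))),
              rotZ θ (EuclideanSpace.single (1 : Fin 3) (1 : ℝ))⟫)) t := by
  have hVc : Continuous V := hV.continuous
  have hVd : Differentiable ℝ V := hV.differentiable one_ne_zero
  have hA := continuous_chartA_radius hVc s
  have hB := continuous_chartB_radius hVc s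
  have hE0 := continuous_chartEntry00_radius hV s
  have hE1 := continuous_chartEntry01_radius hV s
  have hF : Continuous (uncurry fun t θ : ℝ =>
      ⟪V (axisPt s t θ), rotZ θ (EuclideanSpace.single (0 : Fin 3) (1 : ℝ))⟫ ^ 2 -
        ⟪V (axisPt s t θ), rotZ θ (EuclideanSpace.single (1 : Fin 3) (1 : ℝ))⟫ ^ 2) :=
    (hA.pow 2).sub (hB.pow 2)
  have hF' : Continuous (uncurry fun t θ : ℝ =>
      2 * ⟪V (axisPt s t θ), rotZ θ (EuclideanSpace.single (0 : Fin 3) (1 : ℝ))⟫ *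
          ⟪fderiv ℝ V (axisPt s t θ) (rotZ θ (EuclideanSpace.single (0 : Fin 3) (1 : ℝ))),
            rotZ θ (EuclideanSpace.single (0 : Fin 3) (1 : ℝ))⟫ -
        2 * ⟪V (axisPt s t θ), rotZ θ (EuclideanSpace.single (1 : Fin 3) (1 : ℝ))⟫ *
          ⟪fderiv ℝ V (axisPt s t θ) (rotZ θ (EuclideanSpace.single (0 : Fin 3) (1 : ℝ))),
            rotZ θ (EuclideanSpace.single (1 : Fin 3) (1 : ℝ))⟫) :=
    ((continuous_const.mul hA).mul hE0).sub ((continuous_const.mul hB).mul hE1)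
  have hd : ∀ t θ : ℝ, HasDerivAt (fun t : ℝ =>
      ⟪V (axisPt s t θ), rotZ θ (EuclideanSpace.single (0 : Fin 3) (1 : ℝ))⟫ ^ 2 -
        ⟪V (axisPt s t θ), rotZ θ (EuclideanSpace.single (1 : Fin 3) (1 : ℝ))⟫ ^ 2)
      (2 * ⟪V (axisPt s t θ), rotZ θ (EuclideanSpace.single (0 : Fin 3) (1 : ℝ))⟫ *
          ⟪fderiv ℝ V (axisPt s t θ) (rotZ θ (EuclideanSpace.single (0 : Fin 3) (1 : ℝ))),
            rotZ θ (EuclideanSpace.single (0 : Fin 3) (1 : ℝ))⟫ -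
        2 * ⟪V (axisPt s t θ), rotZ θ (EuclideanSpace.single (1 : Fin 3) (1 : ℝ))⟫ *
          ⟪fderiv ℝ V (axisPt s t θ) (rotZ θ (EuclideanSpace.single (0 : Fin 3) (1 : ℝ))),
            rotZ θ (EuclideanSpace.single (1 : Fin 3) (1 : ℝ))⟫) t := by
    intro t θ
    have hA' := hasDerivAt_sliceA_radius hVd s t θ
    have hB' := hasDerivAt_sliceB_radius hVd s t θ
    exact ((hA'.pow 2).sub (hB'.pow 2)).congr_deriv (by push_cast; ring)
  exact (hasDerivAt_intervalIntegral_of_continuous hd hF hF' 0 (2 * Real.pi) t).const_mul _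

/-- **The chart form of the hoop average VANISHES at the axis**: `(2π)⁻¹ ∫₀^{2π} (⟪v, R_θe₀⟫² − ⟪v, R_θe₁⟫²) dθ = 0`
(the integrand is `(v₀² − v₁²) cos 2θ + 2 v₀ v₁ sin 2θ`). [folklore] -/
theorem chartAvg_hoop_zero (V : EuclideanSpace ℝ (Fin 3) → EuclideanSpace ℝ (Fin 3)) (s : ℝ) :
    1 / (2 * Real.pi) * ∫ θ in (0 : ℝ)..2 * Real.pi,
        (⟪V (axisPt s 0 θ), rotZ θ (EuclideanSpace.single (0 : Fin 3) (1 : ℝ))⟫ ^ 2 -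
          ⟪V (axisPt s 0 θ), rotZ θ (EuclideanSpace.single (1 : Fin 3) (1 : ℝ))⟫ ^ 2) = 0 := by
  set v := V (s • eZ) with hv
  have e : (fun θ : ℝ => ⟪V (axisPt s 0 θ), rotZ θ (EuclideanSpace.single (0 : Fin 3) (1 : ℝ))⟫ ^ 2 -
      ⟪V (axisPt s 0 θ), rotZ θ (EuclideanSpace.single (1 : Fin 3) (1 : ℝ))⟫ ^ 2) =
      fun θ : ℝ => (v 0 * Real.cos θ + v 1 * Real.sin θ) ^ 2 - ((-v 0) * Real.sin θ + v 1 * Real.cos θ) ^ 2 := by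
    funext θ
    rw [axisPt_radius_zero, inner_rotZ_single_zero, inner_rotZ_single_one, neg_mul]
  have h1 : IntervalIntegrable (fun θ : ℝ => (v 0 * Real.cos θ + v 1 * Real.sin θ) ^ 2) volume 0 (2 * Real.pi) :=
    (by fun_prop : Continuous fun θ : ℝ => (v 0 * Real.cos θ + v 1 * Real.sin θ) ^ 2).intervalIntegrable _ _
  have h2 : IntervalIntegrable (fun θ : ℝ => ((-v 0) * Real.sin θ + v 1 * Real.cos θ) ^ 2) volume 0 (2 * Real.pi) :=
    (by fun_prop : Continuous fun θ : ℝ => ((-v 0) * Real.sin θ + v 1 * Real.cos θ) ^ 2).intervalIntegrable _ _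
  have h3 : ∫ θ in (0 : ℝ)..2 * Real.pi, ((-v 0) * Real.sin θ + v 1 * Real.cos θ) ^ 2 = Real.pi * (v 1 ^ 2 + (-v 0) ^ 2) := by
    rw [← integral_firstMode_sq (v 1) (-v 0)]
    exact intervalIntegral.integral_congr fun θ _ => by ring
  rw [e, intervalIntegral.integral_sub h1 h2, integral_firstMode_sq, h3]
  ring

/-- **LINEAR BOUND FOR THE CHART HOOP AVERAGE**: for `V ∈ C¹` and `T₀ ≥ 0` there is `C` with
`|(2π)⁻¹ ∫₀^{2π} (A² − B²)(s,t,θ) dθ| ≤ C t` for `t ∈ [0, T₀]` (mean value theorem from the value `0` at `t = 0`). [folklore] -/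
theorem exists_chartAvg_hoop_le_mul (hV : ContDiff ℝ 1 V) (s T₀ : ℝ) :
    ∃ C : ℝ, ∀ t ∈ Icc 0 T₀, |1 / (2 * Real.pi) * ∫ θ in (0 : ℝ)..2 * Real.pi,
        (⟪V (axisPt s t θ), rotZ θ (EuclideanSpace.single (0 : Fin 3) (1 : ℝ))⟫ ^ 2 -
          ⟪V (axisPt s t θ), rotZ θ (EuclideanSpace.single (1 : Fin 3) (1 : ℝ))⟫ ^ 2)| ≤ C * t := by
  -- the derivative is continuous (a parametric integral of a jointly continuous function), hence bounded on `[0, T₀]`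
  have hVc : Continuous V := hV.continuous
  have hA := continuous_chartA_radius hVc s
  have hB := continuous_chartB_radius hVc s
  have hE0 := continuous_chartEntry00_radius hV s
  have hE1 := continuous_chartEntry01_radius hV s
  have hF' : Continuous (uncurry fun t θ : ℝ =>
      2 * ⟪V (axisPt s t θ), rotZ θ (EuclideanSpace.single (0 : Fin 3) (1 : ℝ))⟫ *
          ⟪fderiv ℝ V (axisPt s t θ) (rotZ θ (EuclideanSpace.single (0 : Fin 3) (1 : ℝ))),
            rotZ θ (EuclideanSpace.single (0 : Fin 3) (1 : ℝ))⟫ -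
        2 * ⟪V (axisPt s t θ), rotZ θ (EuclideanSpace.single (1 : Fin 3) (1 : ℝ))⟫ *
          ⟪fderiv ℝ V (axisPt s t θ) (rotZ θ (EuclideanSpace.single (0 : Fin 3) (1 : ℝ))),
            rotZ θ (EuclideanSpace.single (1 : Fin 3) (1 : ℝ))⟫) :=
    ((continuous_const.mul hA).mul hE0).sub ((continuous_const.mul hB).mul hE1)
  have hD : Continuous fun t : ℝ => 1 / (2 * Real.pi) * ∫ θ in (0 : ℝ)..2 * Real.pi,
      (2 * ⟪V (axisPt s t θ), rotZ θ (EuclideanSpace.single (0 : Fin 3) (1 : ℝ))⟫ *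
          ⟪fderiv ℝ V (axisPt s t θ) (rotZ θ (EuclideanSpace.single (0 : Fin 3) (1 : ℝ))),
            rotZ θ (EuclideanSpace.single (0 : Fin 3) (1 : ℝ))⟫ -
        2 * ⟪V (axisPt s t θ), rotZ θ (EuclideanSpace.single (1 : Fin 3) (1 : ℝ))⟫ *
          ⟪fderiv ℝ V (axisPt s t θ) (rotZ θ (EuclideanSpace.single (0 : Fin 3) (1 : ℝ))),
            rotZ θ (EuclideanSpace.single (1 : Fin 3) (1 : ℝ))⟫) :=
    continuous_const.mul (intervalIntegral.continuous_parametric_intervalIntegral_of_continuous' hF' _ _)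
  obtain ⟨C, hC⟩ := isCompact_Icc.exists_bound_of_continuousOn (hD.continuousOn (s := Icc 0 T₀))
  refine ⟨C, fun t ht => ?_⟩
  have hmvt := norm_image_sub_le_of_norm_deriv_le_segment' (a := 0) (b := T₀)
    (fun x _ => (hasDerivAt_chartAvg_hoop hV s x).hasDerivWithinAt) (fun x hx => hC x (Ico_subset_Icc_self hx)) t ht
  rw [chartAvg_hoop_zero V s, sub_zero, sub_zero, Real.norm_eq_abs] at hmvt
  exact hmvt

/-- **THE HOOP INTEGRAND IS A GENUINE INTEGRAND**: for `V ∈ C¹` and `T₀ ≥ 0`,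
`t ↦ circleAvg (V_r² − V_θ²) s t / t` is interval integrable on `[0, T₀]` (bounded and continuous on `(0, T₀]`). [folklore] -/
theorem intervalIntegrable_circleAvg_hoop_div (hV : ContDiff ℝ 1 V) (s : ℝ) {T₀ : ℝ} (hT₀ : 0 ≤ T₀) :
    IntervalIntegrable (fun t : ℝ => circleAvg (fun y => radialVelocity V y ^ 2 - swirlVelocity V y ^ 2) s t / t)
      volume 0 T₀ := by
  obtain ⟨C, hC⟩ := exists_chartAvg_hoop_le_mul hV s T₀
  -- the chart quotient is continuous on `(0, T₀]` and bounded by `C`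
  set H : ℝ → ℝ := fun t => 1 / (2 * Real.pi) * ∫ θ in (0 : ℝ)..2 * Real.pi,
      (⟪V (axisPt s t θ), rotZ θ (EuclideanSpace.single (0 : Fin 3) (1 : ℝ))⟫ ^ 2 -
        ⟪V (axisPt s t θ), rotZ θ (EuclideanSpace.single (1 : Fin 3) (1 : ℝ))⟫ ^ 2) with hH
  have hHc : Continuous H :=
    continuous_iff_continuousAt.2 fun t => (hasDerivAt_chartAvg_hoop hV s t).continuousAt
  have hq : ContinuousOn (fun t : ℝ => H t / t) (Ioc 0 T₀) :=
    hHc.continuousOn.div continuousOn_id fun t ht => ht.1.ne'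
  have hInt : IntegrableOn (fun t : ℝ => H t / t) (Ioc 0 T₀) volume := by
    refine Integrable.mono' (g := fun _ => C) (integrableOn_const (by simp)) (hq.aestronglyMeasurable measurableSet_Ioc) ?_
    refine (ae_restrict_iff' measurableSet_Ioc).2 (Filter.Eventually.of_forall fun t ht => ?_)
    have hb := hC t ⟨ht.1.le, ht.2⟩
    rw [Real.norm_eq_abs, abs_div, abs_of_pos ht.1, div_le_iff₀ ht.1]
    exact hb
  rw [intervalIntegrable_iff_integrableOn_Ioc_of_le hT₀]
  refine hInt.congr_fun (fun t ht => ?_) measurableSet_Ioc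
  rw [hH, circleAvg_hoop_eq_chart V s ht.1]

end Summit.NavierStokesRegularity.NavierStokesRegularity.Theorems.PowerGaugeEulerLiouville.HoopCore

end
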